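import Summits.ResolutionOfSingularities.ResolutionOfSingularities.Theorems.MarkedTransferCampaignW23FlagDescentBookkeeping
import Mathlib.RingTheory.MvPolynomial.Ideal
import Mathlib.RingTheory.MvPolynomial.Expand
import Mathlib.RingTheory.MvPolynomial.Basic
import Mathlib.RingTheory.Polynomial.Basic
import Mathlib.Algebra.Polynomial.Derivative
import Mathlib.Algebra.Polynomial.Div
import Mathlib.Algebra.CharP.Reduced
import Mathlib.Algebra.CharP.Algebra
import Mathlib.Algebra.CharP.Two
import Mathlib.RingTheory.AdjoinRoot
import Mathlib.RingTheory.Finiteness.Cardinality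
import Mathlib.Data.Fintype.Card
import HarnessLib

/-!
# [OURS · L1 W2.3 · K2.3b] The flag bottom along a positive-dimensional singular locus: Example C′
# («pointwise heads everywhere on the line, a uniform head nowhere»)

HONEST FRAMING. Everything below is OURS (cell `res-hironaka`, run/shared/lean/pub/res-hironaka/, rung L of
LADDER-RESOLUTION, RESCUE-SEED slot W2.3 «TAILS WITHOUT H♭», kill-test seat `res-L1-k23`, generation 2) or
elementary commutative algebra over `𝔽₂`; NOTHING here is a statement of H. Hironaka's manuscript *Resolution of
singularities in positive characteristics* (2017-03-23, [Hironaka2017]) and nothing asserts that any statement of that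
manuscript holds. The manuscript's objects enter ONLY through the typed carrier of rung S rows 098/099
(`S16Proof.InductionInput`, `theta`, `theta_ours`; §16.4 Def. 16.15/16.16 p.88) via the OURS bookkeeping of
`Theorems/MarkedTransferCampaignW23FlagDescentBookkeeping.lean` (p464759). AI review is weaker than expert review.

WHAT THIS FILE IS. The pre-registered probe K2.3b of the kill test K2.3 (HOME L/res-L1-k23/PREREG-K2.3b.md, STATUS
«KILL-TEST K2.3b REGISTERED» 2026-08-26T23:26Z; K2.3 itself is ALIVE, report L/res-L1-k23/KILL-TEST-K2.3.md): the
typed flag bottom `Θ(Ě′,1)` read on the SMALLEST instance with a one-dimensional singular locus — DOSSIER group-2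
§3.5's «Example C» after one blow-up (`CampaignW23.ExampleCPrime.recentre`, p465442): at the point `ξ′` of the
exceptional divisor the controlled transform is the LL-head SHAPE `g′ = y″² + x₁²·φ(s)`, `φ(s) = s³ + s² + s`, and
the order-`≥ 2` locus through `ξ′` is the line `L₁ = V(x₁, y″)` with coordinate `s`. We work in
`O = 𝔽₂[s][x₁, y″]` (`R := 𝔽₂[s]` the coordinate ring of `L₁`, `B := R[x₁,y″]`, `x₁ = X 0`, `y″ = X 1`), with the
MODEL `I^{(m)}(Sing) := (x₁, y″)^m = idealOfVars^m` (Eq. (91) read at `Sing = L₁`; symbolic = ordinary power).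
* §1 (the coordinate ring of `L₁`): `φ′ = (s+1)²` and the INTERNAL CERTIFICATE `eq_zero_of_phi_mul_sq`:
  `φ·a² = b²` in `𝔽₂[s]` forces `a = b = 0` (differentiate: squares have zero derivative in characteristic `2`).
* §2 (UNIFORM HEAD NOWHERE): `eq_zero_of_C_mul_gC_eq_sq_add` — if `u(s)·g′ = z² + r` with `r ∈ I^{(3)}(L₁)` then
  `u = 0`; hence `no_uniform_head`: `g′` is NOT of the form `z² + r`, `r ∈ I^{(3)}(L₁)`, for ANY `z ∈ B` — no single
  parameter `z` satisfies Def. 6.12 Eq. (52) along `L₁` (compare the coefficients of `y″²` and `x₁²`, which for a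
  square are squares of coefficients of `z`: `MvPolynomial.map_frobenius_expand`); and `mem_sq_of_sq_mem`:
  every `t` with `t² ∈ (g′) + I^{(3)}(L₁)` lies in `I^{(2)}(L₁)`.
* §3 (POINTWISE HEAD EVERYWHERE): `exists_pointwise_head` — for EVERY maximal ideal `𝔫` of `𝔽₂[s]` (every closed
  point `η = (0, s(η), 0)` of `L₁`) there is `c ∈ 𝔽₂[s]` with `φ − c² ∈ 𝔫` (the residue field is finite, hence
  perfect), and then `g′ = (y″ + c·x₁)² + (φ − c²)·x₁²` with the tail in `𝔪_η³`, `𝔪_η = (𝔫, x₁, y″)`: Eq. (52)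
  holds AT `η` for the parameter `y″ + c(s)·x₁` — a different one at each point (`c ≡ √φ(s(η))`), e.g. `c = 0` at
  `ξ′` (`s = 0`) and `c = 1` at `s = 1` (`φ + 1 = (s+1)³`).
* §4 (THE TYPED FLAG, test T1′ of the PREREG): the line model `lineBundle` of the §16.4 bundle (`p = 2`, `e = 1`,
  `𝔏(Ě′,2) := L1` and `℘nega := P` parameters, `I^{(m)}(Sing) := idealOfVars^m`) and `theta_ours_zero_le` /
  `theta_zero_le`: for EVERY `ρ^ℓ(O)`-module `L1 ⊆ (g′)·O + I^{(3)}(L₁)` (the PREREG's MODEL of `𝔏(Ě′,2)`: every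
  order-2 head along `L₁` an `O`-multiple of `g′` up to order-3 terms — the minimal reading `ρ^ℓ(O)·g′` and `𝔏 = 0`
  included) and EVERY `℘nega`, BOTH typed readings of the flag bottom are contained in `I^{(2)}(L₁) ⊆ 𝔪_ξ′²`:
  `Θ(Ě′,1)` has NO element of order `1` at `ξ′` — T1′ = NO (PREREG outcome «REACH-DEAD-UPSTREAM, GLUING-ONLY»).
  CONTRAST (`point_model_y_mem_theta_ours_zero`): read with `Sing := {ξ′}` (the K2.3 point model `pointBundle`,
  p464759 — the WRONG model here since `Sing ⊇ L₁`) the same head shape puts `y″` in the flag bottom: the outcome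
  is decided by the uniformity clause «∀ η ∈ Sing(Ě)_cl ∩ V» of Eq. (52), not by `℘nega` or by the descent.
READING (NOT kernel content, NOT a verdict, NOT a claim about the manuscript): on this instance a tails recipe built
on `𝔏(Ě′, q)` (`H♭`, the §16.4 flag, or OURS) is empty-handed at `ξ′` unless `℘(Ě′)_2` supplies quadratic classes
along `L₁` other than the multiples of `[g′]` (OUT OF MODEL: needs `℘(Ě′)` on the instance, GAP rows R12/R20,
res-type-056's R-V feasibility note §2 (P5)); the obstruction is GLUING ONLY (§3 vs §2) — the «uniform edge
generators along V ∩ Sing(Ě)» of Th. 6.14 (1) (GAP row R20; R18 = the W-Q family). No catalogued barrier is claimed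
hit (nearest MECHANISM, analogy only: a non-square over the imperfect function field `𝔽₂(s)` of `L₁`,
`RegularNotGeometricallyRegular` / `InseparableBaseChange`). Slot W2.3 is NOT scored here (K2.3 = ALIVE stands).
VACUITY SELF-CHECK: §2's hypotheses force `u = 0` (the content); §3 is proved by construction for every `𝔫`
(explicitly at `s = 0`, `s = 1`); §4's hypothesis is met by `L1 = ρ^ℓ(O)·g′` (`theta_ours_zero_le_minimal`) and its
conclusion fails for `t = y″` in the point model (§4 contrast) — neither side is vacuous.

## References
* Cell files (OURS): L/res-L1-k23/PREREG-K2.3b.md, KILL-TEST-K2.3.md §5–§6, ledger/group-2/DOSSIER.md §3.5,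
  ledger/evidence/R05/res-type-056-RV-feasibility.md §2; GAP-LEDGER rows R20, R18, R06. Tree: p464759
  (`pointBundle`, `pow_mem_of_mem_theta_ours_zero`), p465442 (`ExampleCPrime.recentre`, `phi_not_isSquare`), p467192.
* H. Hironaka, ms. 2017-03-23: Def. 6.12 Eq. (52)–(53) p.33; Th. 6.14 (1) p.34; Eq. (91) p.62; §16.4 Def. 16.15/16.16
  p.88 — scope only, under adjudication, not cited as fact. [Hironaka2017]
-/

set_option linter.dupNamespace false -- mandated namespace of this single-conjunct summit

namespace Summit.ResolutionOfSingularities.ResolutionOfSingularities.Theorems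

namespace CampaignW23

namespace ExampleCPrime

open Literature.AlgebraicGeometry.Hironaka2017.S16Proof

/-! ## §1 — the coordinate ring `𝔽₂[s]` of the line `L₁` and the internal certificate -/

section CoordRing

open Polynomial

/-- [OURS · L1 W2.3 · K2.3b] `R = 𝔽₂[s]`, the coordinate ring of the line `L₁ = V(x₁, y″)` (`s = X`).
[folklore] -/
abbrev R := (ZMod 2)[X]

/-- [OURS · L1 W2.3 · K2.3b] `φ(s) = s³ + s² + s`, the coefficient of `x₁²` in the controlled transform
`g′ = y″² + x₁²φ(s)` at `ξ′` (`CampaignW23.ExampleCPrime.recentre`, p465442). REAL definition. [folklore] -/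
noncomputable def phi : R := X ^ 3 + X ^ 2 + X

/-- `φ′(s) = 3s² + 2s + 1 = (s + 1)²` in characteristic `2`. [folklore] -/
theorem derivative_phi : derivative phi = (X + 1) ^ 2 := by
  have h2 : (2 : R) = 0 := CharTwo.two_eq_zero
  have h : derivative phi = 3 * X ^ 2 + 2 * X + 1 := by
    simp only [phi, derivative_add, derivative_X_pow, derivative_X, Nat.cast_ofNat, map_ofNat]
    norm_num
  rw [h]
  linear_combination (X ^ 2 : R) * h2

/-- [OURS · L1 W2.3 · K2.3b] THE INTERNAL CERTIFICATE: in `𝔽₂[s]`, `φ·a² = b²` forces `a = 0` and `b = 0`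
(differentiate: `(b²)′ = 0 = (a²)′` in characteristic `2`, so `(s+1)²a² = 0`). In particular `φ` is not a square
(`a = 1`; cf. `phi_not_isSquare`, p465442) and no `𝔽₂[s]`-multiple `u·(ȳ″² + φ·x̄₁²)`, `u ≠ 0`, of the quadratic
class of `g′` along `L₁` is a square class `ā²ȳ″² + b̄²x̄₁²`. [folklore] -/
theorem eq_zero_of_phi_mul_sq {a b : R} (h : phi * a ^ 2 = b ^ 2) : a = 0 ∧ b = 0 := by
  have hC2 : (C (2 : ZMod 2) : R) = 0 := by
    rw [show (2 : ZMod 2) = 0 from rfl, map_zero]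
  have hd := congrArg derivative h
  rw [derivative_mul, derivative_sq, derivative_sq, derivative_phi] at hd
  have hsq : ((X + 1) * a) ^ 2 = 0 := by
    linear_combination hd + (b * derivative b - phi * a * derivative a) * hC2
  have hX : (X + 1 : R) ≠ 0 := by
    rw [← C_1]
    exact X_add_C_ne_zero 1
  have ha : a = 0 := by
    rcases mul_eq_zero.mp (pow_eq_zero_iff (two_ne_zero) |>.mp hsq) with h1 | h1
    · exact absurd h1 hX
    · exact h1
  refine ⟨ha, ?_⟩
  rw [ha] at h
  have : b ^ 2 = 0 := by rw [← h]; ring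
  exact pow_eq_zero_iff two_ne_zero |>.mp this

/-- At the closed point `s = 1` of `L₁`: `φ + 1 = (s + 1)³`, so `φ ≡ 1² (mod (s+1))` (pointwise root `c = 1`).
[folklore] -/
theorem phi_add_one : phi + 1 = (X + 1) ^ 3 := by
  have h2 : (2 : R) = 0 := CharTwo.two_eq_zero
  unfold phi
  linear_combination (-(X ^ 2 + X) : R) * h2

/-- [OURS · L1 W2.3 · K2.3b] POINTWISE SQUARE ROOTS: for every maximal ideal `𝔫` of `𝔽₂[s]` (every closed point of
the line `L₁`) there is `c ∈ 𝔽₂[s]` with `φ − c² ∈ 𝔫` — the residue field `𝔽₂[s]/𝔫` is a finite field of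
characteristic `2`, on which the Frobenius is injective (`frobenius_inj`) hence surjective. [folklore] -/
theorem exists_sq_sub_mem (𝔫 : Ideal R) [h𝔫 : 𝔫.IsMaximal] : ∃ c : R, phi - c ^ 2 ∈ 𝔫 := by
  classical
  -- the quotient is a finite field of characteristic 2
  set f : R := Submodule.IsPrincipal.generator 𝔫 with hf
  have h𝔫f : 𝔫 = Ideal.span {f} := (Ideal.span_singleton_generator 𝔫).symm
  have hne : 𝔫 ≠ ⊥ := Ring.ne_bot_of_isMaximal_of_not_isField h𝔫 (Polynomial.not_isField (ZMod 2))
  have hf0 : f ≠ 0 := by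
    intro h0
    apply hne
    rw [h𝔫f, h0, Ideal.span_singleton_eq_bot]
  haveI : Module.Finite (ZMod 2) (AdjoinRoot f) := (AdjoinRoot.powerBasis hf0).finite
  haveI : Finite (AdjoinRoot f) := Module.finite_of_finite (ZMod 2)
  haveI : Finite (R ⧸ 𝔫) := Finite.of_equiv (AdjoinRoot f) (Ideal.quotEquivOfEq h𝔫f.symm).toEquiv
  haveI : CharP (R ⧸ 𝔫) 2 :=
    charP_of_injective_algebraMap (algebraMap (ZMod 2) (R ⧸ 𝔫)).injective 2
  have hsurj : Function.Surjective (frobenius (R ⧸ 𝔫) 2) :=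
    Finite.injective_iff_surjective.mp (frobenius_inj (R ⧸ 𝔫) 2)
  obtain ⟨cbar, hc⟩ := hsurj (Ideal.Quotient.mk 𝔫 phi)
  obtain ⟨c, rfl⟩ := Ideal.Quotient.mk_surjective cbar
  refine ⟨c, ?_⟩
  rw [← Ideal.Quotient.eq_zero_iff_mem, map_sub, map_pow, ← hc, frobenius_def, sub_self]

end CoordRing

/-! ## §2 — `O = 𝔽₂[s][x₁, y″]`: a uniform head exists nowhere along `L₁` -/

section Plane

open MvPolynomial

/-- [OURS · L1 W2.3 · K2.3b] `B = 𝔽₂[s][x₁, y″]`, the affine coordinate ring around `ξ′` fibred over the line `L₁`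
(`x₁ = X 0`, `y″ = X 1`; `I(L₁) = idealOfVars`). [folklore] -/
abbrev B := MvPolynomial (Fin 2) R

/-- [OURS · L1 W2.3 · K2.3b] the controlled transform at `ξ′`, `g′ = y″² + φ(s)·x₁²`
(`CampaignW23.ExampleCPrime.recentre` with `s` moved into the coefficient ring). REAL definition. [folklore] -/
noncomputable def gC : B := X 1 ^ 2 + C phi * X 0 ^ 2

/-- In characteristic `2`, `coeff_{2m}(z²) = (coeff_m z)²` (`MvPolynomial.map_frobenius_expand`). [folklore] -/
theorem coeff_sq_two_nsmul {σ S : Type*} [CommRing S] [CharP S 2] (z : MvPolynomial σ S) (m : σ →₀ ℕ) :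
    (z ^ 2).coeff (2 • m) = (z.coeff m) ^ 2 := by
  rw [← MvPolynomial.map_frobenius_expand 2 (f := z), MvPolynomial.coeff_map,
    MvPolynomial.coeff_expand_smul 2 two_ne_zero, frobenius_def]

/-- Special case: `coeff_{X_i²}(z²) = (coeff_{X_i} z)²`. [folklore] -/
theorem coeff_sq_single {σ S : Type*} [CommRing S] [CharP S 2] (z : MvPolynomial σ S) (i : σ) :
    (z ^ 2).coeff (Finsupp.single i 2) = (z.coeff (Finsupp.single i 1)) ^ 2 := by
  rw [show Finsupp.single i 2 = 2 • Finsupp.single i 1 by rw [Finsupp.smul_single]; rfl]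
  exact coeff_sq_two_nsmul z _

/-- `coeff_{y″²} g′ = 1`. [folklore] -/
theorem coeff_gC_y2 : gC.coeff (Finsupp.single 1 2) = 1 := by
  simp [gC, coeff_X_pow, Finsupp.single_eq_single_iff]

/-- `coeff_{x₁²} g′ = φ`. [folklore] -/
theorem coeff_gC_x2 : gC.coeff (Finsupp.single 0 2) = phi := by
  simp [gC, coeff_X_pow, Finsupp.single_eq_single_iff]

/-- `g′ ∈ I(L₁)² = (x₁, y″)²` (order `2` along the whole line). [folklore] -/
theorem gC_mem_sq : gC ∈ idealOfVars (Fin 2) R ^ 2 := by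
  have hx : (X 0 : B) ∈ idealOfVars (Fin 2) R := Ideal.subset_span ⟨0, rfl⟩
  have hy : (X 1 : B) ∈ idealOfVars (Fin 2) R := Ideal.subset_span ⟨1, rfl⟩
  rw [pow_two]
  refine Ideal.add_mem _ ?_ ?_
  · rw [pow_two]; exact Ideal.mul_mem_mul hy hy
  · rw [pow_two, ← mul_assoc]
    exact Ideal.mul_mem_mul (Ideal.mul_mem_left _ _ hx) hx

/-- [OURS · L1 W2.3 · K2.3b] NO UNIFORM HEAD AMONG THE MULTIPLES OF `g′`: if `u(s)·g′ = z² + r` with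
`r ∈ I^{(3)}(L₁) = (x₁,y″)³` then `u = 0` (coefficients of `y″²` and `x₁²`: `u = a²`, `u·φ = b²`, hence
`φ·a² = b²`, `eq_zero_of_phi_mul_sq`). [folklore] -/
theorem eq_zero_of_C_mul_gC_eq_sq_add (u : R) {z r : B} (hr : r ∈ idealOfVars (Fin 2) R ^ 3)
    (h : C u * gC = z ^ 2 + r) : u = 0 := by
  have hr' := (mem_pow_idealOfVars_iff' 3 r).mp hr
  have hr1 : r.coeff (Finsupp.single 1 2) = 0 := hr' _ (by rw [Finsupp.degree_single]; norm_num)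
  have hr0 : r.coeff (Finsupp.single 0 2) = 0 := hr' _ (by rw [Finsupp.degree_single]; norm_num)
  have e1 : u = (z.coeff (Finsupp.single 1 1)) ^ 2 := by
    have := congrArg (MvPolynomial.coeff (Finsupp.single (1 : Fin 2) 2)) h
    rwa [coeff_C_mul, coeff_gC_y2, mul_one, coeff_add, coeff_sq_single, hr1, add_zero] at this
  have e2 : u * phi = (z.coeff (Finsupp.single 0 1)) ^ 2 := by
    have := congrArg (MvPolynomial.coeff (Finsupp.single (0 : Fin 2) 2)) h
    rwa [coeff_C_mul, coeff_gC_x2, coeff_add, coeff_sq_single, hr0, add_zero] at this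
  have key : phi * (z.coeff (Finsupp.single 1 1)) ^ 2 = (z.coeff (Finsupp.single 0 1)) ^ 2 := by
    rw [← e1, mul_comm, e2]
  obtain ⟨ha, -⟩ := eq_zero_of_phi_mul_sq key
  rw [e1, ha, zero_pow two_ne_zero]

/-- [OURS · L1 W2.3 · K2.3b] UNIFORM HEAD NOWHERE: `g′ = y″² + x₁²φ(s)` is not `z² + r` with `r ∈ I^{(3)}(L₁)` for
ANY `z ∈ 𝔽₂[s][x₁,y″]` — no single parameter `z` makes Def. 6.12 Eq. (52) hold at every closed point of `L₁`
(replaces the role of «LL-head of order q along Sing(Ě) ∩ V», Eq. (52) p.33, on this instance; NOT a statement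
of the manuscript). [folklore] -/
theorem no_uniform_head : ¬ ∃ z r : B, r ∈ idealOfVars (Fin 2) R ^ 3 ∧ gC = z ^ 2 + r := by
  rintro ⟨z, r, hr, h⟩
  have := eq_zero_of_C_mul_gC_eq_sq_add 1 hr (by rw [map_one, one_mul]; exact h)
  exact one_ne_zero this

/-- In characteristic `2`, `t² ∈ I(L₁)³` forces `t ∈ I(L₁)²` (a monomial of `I(L₁)`-degree `d ≤ 1` in `t` gives
the monomial of degree `2d ≤ 2` in `t²` with coefficient the square of a nonzero element of the domain `𝔽₂[s]`).
[folklore] -/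
theorem mem_sq_of_sq_mem_cube {t : B} (h : t ^ 2 ∈ idealOfVars (Fin 2) R ^ 3) :
    t ∈ idealOfVars (Fin 2) R ^ 2 := by
  rw [mem_pow_idealOfVars_iff'] at h ⊢
  intro x hx
  have h2x : (t ^ 2).coeff (2 • x) = 0 := h (2 • x) (by rw [map_nsmul, smul_eq_mul]; omega)
  rw [coeff_sq_two_nsmul] at h2x
  exact pow_eq_zero_iff two_ne_zero |>.mp h2x

/-- [OURS · L1 W2.3 · K2.3b] Every `t` with `t² ∈ (g′)·O + I^{(3)}(L₁)` lies in `I^{(2)}(L₁)`: write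
`t² = w·g′ + r`, reduce `w` modulo `I(L₁)` to `u(s)`, get `u = 0` (`eq_zero_of_C_mul_gC_eq_sq_add`), then
`t² ∈ I^{(3)}` and `t ∈ I^{(2)}` (`mem_sq_of_sq_mem_cube`). [folklore] -/
theorem mem_sq_of_sq_mem {t : B}
    (ht : t ^ 2 ∈ Ideal.span {gC} ⊔ idealOfVars (Fin 2) R ^ 3) : t ∈ idealOfVars (Fin 2) R ^ 2 := by
  obtain ⟨w, r, hr, hwr⟩ := Ideal.mem_span_singleton_sup.mp ht
  set u : R := w.coeff 0 with hu_def
  have hw' : w - C u ∈ idealOfVars (Fin 2) R := by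
    rw [← pow_one (idealOfVars (Fin 2) R), mem_pow_idealOfVars_iff']
    intro x hx
    have hx0 : x = 0 := (Finsupp.degree_eq_zero_iff x).mp (by omega)
    subst hx0
    simp [hu_def]
  have hr3 : (w - C u) * gC + r ∈ idealOfVars (Fin 2) R ^ 3 := by
    refine Ideal.add_mem _ ?_ hr
    have := Ideal.mul_mem_mul hw' gC_mem_sq
    rwa [← pow_succ'] at this
  have hu : u = 0 :=
    eq_zero_of_C_mul_gC_eq_sq_add u (z := t) (r := -((w - C u) * gC + r)) (neg_mem hr3)
      (by linear_combination hwr)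
  have ht3 : t ^ 2 ∈ idealOfVars (Fin 2) R ^ 3 := by
    have : t ^ 2 = (w - C u) * gC + r := by rw [hu, map_zero, sub_zero]; exact hwr.symm
    rw [this]; exact hr3
  exact mem_sq_of_sq_mem_cube ht3

/-! ## §3 — pointwise heads at every closed point of `L₁` -/

/-- [OURS · L1 W2.3 · K2.3b] the maximal ideal `𝔪_η = (𝔫, x₁, y″)` of the closed point `η` of `L₁` lying over the
maximal ideal `𝔫` of `𝔽₂[s]`. REAL definition. [folklore] -/
noncomputable def maxAt (𝔫 : Ideal R) : Ideal B := 𝔫.map (C : R →+* B) ⊔ idealOfVars (Fin 2) R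

/-- The head identity at a point: `g′ = (y″ + c·x₁)² + (φ − c²)·x₁²` for every `c ∈ 𝔽₂[s]` (characteristic `2`).
[folklore] -/
theorem gC_eq_sq_add (c : R) : gC = (X 1 + C c * X 0) ^ 2 + C (phi - c ^ 2) * X 0 ^ 2 := by
  have h2 : (2 : B) = 0 := CharTwo.two_eq_zero
  simp only [gC, map_sub, map_pow]
  linear_combination (-(X 1 * C c * X 0) : B) * h2

/-- [OURS · L1 W2.3 · K2.3b] POINTWISE HEAD EVERYWHERE ON `L₁`: for every maximal ideal `𝔫` of `𝔽₂[s]` (every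
closed point `η` of `L₁`) there is `c ∈ 𝔽₂[s]` with `φ − c² ∈ 𝔫`, `g′ = (y″ + c·x₁)² + (φ − c²)·x₁²`, and the
tail `(φ − c²)·x₁² ∈ 𝔪_η³` — Def. 6.12 Eq. (52) holds AT `η` for the regular parameter `y″ + c(s)·x₁` (replaces the
role of «g is an LL-head at the point η», Eq. (52) p.33 read pointwise; NOT a statement of the manuscript).
Together with `no_uniform_head`: heads exist at every point of the line and on no neighbourhood of any point.
[folklore] -/
theorem exists_pointwise_head (𝔫 : Ideal R) [𝔫.IsMaximal] :
    ∃ c : R, phi - c ^ 2 ∈ 𝔫 ∧ gC = (X 1 + C c * X 0) ^ 2 + C (phi - c ^ 2) * X 0 ^ 2 ∧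
      C (phi - c ^ 2) * X 0 ^ 2 ∈ maxAt 𝔫 ^ 3 := by
  obtain ⟨c, hc⟩ := exists_sq_sub_mem 𝔫
  refine ⟨c, hc, gC_eq_sq_add c, ?_⟩
  have h1 : (C (phi - c ^ 2) : B) ∈ maxAt 𝔫 :=
    Ideal.mem_sup_left (Ideal.mem_map_of_mem _ hc)
  have hx : (X 0 : B) ∈ maxAt 𝔫 := Ideal.mem_sup_right (Ideal.subset_span ⟨0, rfl⟩)
  have key : ∀ a b d : B, a ∈ maxAt 𝔫 → b ∈ maxAt 𝔫 → d ∈ maxAt 𝔫 → a * b * d ∈ maxAt 𝔫 ^ 3 := by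
    intro a b d ha hb hd
    rw [pow_succ, pow_succ, pow_one]
    exact Ideal.mul_mem_mul (Ideal.mul_mem_mul ha hb) hd
  have e : (C (phi - c ^ 2) * X 0 ^ 2 : B) = C (phi - c ^ 2) * X 0 * X 0 := by ring
  rw [e]
  exact key _ _ _ h1 hx hx

/-- The two `𝔽₂`-rational points of `L₁` explicitly: at `ξ′` (`𝔫 = (s)`) take `c = 0` (`φ ∈ (s)`), at `s = 1`
(`𝔫 = (s+1)`) take `c = 1` (`φ − 1 = (s+1)³`). [folklore] -/
theorem pointwise_head_rational :
    (phi - 0 ^ 2 ∈ Ideal.span ({Polynomial.X} : Set R)) ∧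
      (phi - 1 ^ 2 ∈ Ideal.span ({Polynomial.X + 1} : Set R)) := by
  constructor
  · rw [Ideal.mem_span_singleton]
    exact ⟨Polynomial.X ^ 2 + Polynomial.X + 1, by unfold phi; ring⟩
  · rw [Ideal.mem_span_singleton]
    refine ⟨(Polynomial.X + 1) ^ 2, ?_⟩
    have h2 : (2 : R) = 0 := CharTwo.two_eq_zero
    have := phi_add_one
    linear_combination this + (-1 : R) * h2

/-! ## §4 — the typed §16.4 flag on the line model: test T1′ -/

variable (ℓ : ℕ)

/-- [OURS · L1 W2.3 · K2.3b] THE LINE MODEL of the §16.4 bundle at `ξ′` with `Sing(Ě′)_cl ∩ V = L₁ ∩ V`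
(PREREG-K2.3b «MODEL»): `O = 𝔽₂[s][x₁,y″]`, `e = 1` (`q = 2`), `𝔏(Ě′,2) := L1` and `℘nega(Ě′,−a) := P a`
parameters, `I^{(m)}(Sing) := I(L₁)^m = idealOfVars^m` (Eq. (91) at `Sing = L₁`); `𝔏(Ě′,q(k))`, `k ≠ 1`, unused at
`e = 1` and set to `⊥`. The line analogue of `CampaignW23.pointBundle` (p464759). REAL definition; NOT a statement
of the manuscript. [folklore] -/
noncomputable def lineBundle (L1 : Submodule (iterateFrobenius B 2 ℓ).range B) (P : ℕ → Ideal B) :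
    InductionInput 2 B ℓ where
  e := 1
  L := fun k => if k = 1 then L1 else ⊥
  pnega := P
  iSing := fun m => idealOfVars (Fin 2) R ^ m

variable (L1 : Submodule (iterateFrobenius B 2 ℓ).range B) (P : ℕ → Ideal B)

/-- [OURS · L1 W2.3 · K2.3b **T1′ = NO**, OURS reading] For every `𝔏(Ě′,2) ⊆ (g′)·O + I^{(3)}(L₁)` and every
`℘nega`, the flag bottom `Θ(Ě′,1)` (row 099 `theta_ours`, uniform bracket) is contained in `I^{(2)}(L₁)`: it has no
element of order `1` at `ξ′` (nor at any point of `L₁`). [folklore] -/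
theorem theta_ours_zero_le (hL : L1 ≤ (Ideal.span {gC} ⊔ idealOfVars (Fin 2) R ^ 3).restrictScalars _)
    {t : B} (ht : t ∈ (lineBundle ℓ L1 P).theta_ours 0) : t ∈ idealOfVars (Fin 2) R ^ 2 :=
  mem_sq_of_sq_mem
    (pow_mem_of_mem_theta_ours_zero (lineBundle ℓ L1 P) rfl (J := Ideal.span {gC} ⊔ idealOfVars (Fin 2) R ^ 3)
      (by simpa [lineBundle] using hL) (by simp [lineBundle]) ht)

/-- [OURS · L1 W2.3 · K2.3b **T1′ = NO**, AS-PRINTED reading] The same for row 099's `theta` (Def. 16.16 as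
printed; equal to `theta_ours` at the bottom when `e = 1`, `theta_zero_eq_theta_ours_zero`). [folklore] -/
theorem theta_zero_le (hL : L1 ≤ (Ideal.span {gC} ⊔ idealOfVars (Fin 2) R ^ 3).restrictScalars _)
    {t : B} (ht : t ∈ (lineBundle ℓ L1 P).theta 0) : t ∈ idealOfVars (Fin 2) R ^ 2 := by
  rw [theta_zero_eq_theta_ours_zero _ rfl] at ht
  exact theta_ours_zero_le ℓ L1 P hL ht

/-- [OURS · L1 W2.3 · K2.3b **T1′ = NO**, minimal instance, hypothesis-free] With `𝔏(Ě′,2) := ρ^ℓ(O)·g′`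
(the span of the one head shape) and ANY `℘nega`: `Θ(Ě′,1) ⊆ I^{(2)}(L₁)`. [folklore] -/
theorem theta_ours_zero_le_minimal {t : B}
    (ht : t ∈ (lineBundle ℓ (Submodule.span _ {gC}) P).theta_ours 0) : t ∈ idealOfVars (Fin 2) R ^ 2 := by
  refine theta_ours_zero_le ℓ _ P ?_ ht
  rw [Submodule.span_le]
  rintro _ rfl
  exact Ideal.mem_sup_left (Ideal.mem_span_singleton_self _)

/-- `I^{(2)}(L₁) ⊆ 𝔪_ξ′²` (`𝔪_ξ′ = (s, x₁, y″) = maxAt (s)`): an element of `I^{(2)}(L₁)` has order `≥ 2` at `ξ′`,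
so T1′ = NO indeed means «no element of order 1 at ξ′». [folklore] -/
theorem sq_le_maxAt_sq (𝔫 : Ideal R) : idealOfVars (Fin 2) R ^ 2 ≤ maxAt 𝔫 ^ 2 :=
  Ideal.pow_right_mono le_sup_right 2

/-- [OURS · L1 W2.3 · K2.3b, CONTRAST] The same head SHAPE read in the K2.3 POINT model (`Sing := {ξ′}`,
`I^{(m)}(Sing) := 𝔪_ξ′^m`, `CampaignW23.pointBundle` over `𝔽₂[x₁, s, y″]`, p464759) — the WRONG model on this
instance (`Sing ⊇ L₁`), recorded only to exhibit what decides the test: there `y″` IS in the flag bottom, because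
`x₁²(s³+s²+s) ∈ 𝔪_ξ′³`. (`x₁ = X 0`, `s = X 1`, `y″ = X 2`.) [folklore] -/
theorem point_model_y_mem_theta_ours_zero
    (L1' : Submodule (iterateFrobenius (MvPolynomial (Fin 3) (ZMod 2)) 2 ℓ).range (MvPolynomial (Fin 3) (ZMod 2)))
    (P' : ℕ → Ideal (MvPolynomial (Fin 3) (ZMod 2)))
    (hgL : (X 2 ^ 2 + X 0 ^ 2 * (X 1 ^ 3 + X 1 ^ 2 + X 1) : MvPolynomial (Fin 3) (ZMod 2)) ∈ L1')
    (hεn : (X 0 ^ 2 * (X 1 ^ 3 + X 1 ^ 2 + X 1) : MvPolynomial (Fin 3) (ZMod 2)) ∈ P' 1) :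
    (X 2 : MvPolynomial (Fin 3) (ZMod 2)) ∈ (pointBundle ℓ L1' P').theta_ours 0 := by
  refine pointBundle_mem_theta_ours_zero ℓ L1' P' rfl hgL hεn ?_
  set m : Ideal (MvPolynomial (Fin 3) (ZMod 2)) := idealOfVars (Fin 3) (ZMod 2)
  have hx : (X 0 : MvPolynomial (Fin 3) (ZMod 2)) ∈ m := Ideal.subset_span ⟨0, rfl⟩
  have hs : (X 1 : MvPolynomial (Fin 3) (ZMod 2)) ∈ m := Ideal.subset_span ⟨1, rfl⟩
  have h3 : (X 0 * X 0 * X 1 : MvPolynomial (Fin 3) (ZMod 2)) ∈ m ^ 3 := by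
    rw [pow_succ, pow_succ, pow_one]
    exact Ideal.mul_mem_mul (Ideal.mul_mem_mul hx hx) hs
  have : (X 0 ^ 2 * (X 1 ^ 3 + X 1 ^ 2 + X 1) : MvPolynomial (Fin 3) (ZMod 2)) =
      X 0 * X 0 * X 1 * (X 1 ^ 2 + X 1 + 1) := by ring
  rw [this]
  exact Ideal.mul_mem_right _ _ h3

end Plane

end ExampleCPrime

end CampaignW23

end Summit.ResolutionOfSingularities.ResolutionOfSingularities.Theorems
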